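import Summits.Ventures.HodgeRepro2.T5SU11PhaseTailCartan
import Summits.Ventures.HodgeRepro2.T5SU11OrbitRadiusLaw
import Summits.Ventures.HodgeRepro2.T5SU11JacobiWendelBounds
import Summits.Ventures.HodgeRepro2.T5SU11JacobiMeanPhaseAsymptotic
import Summits.Ventures.HodgeRepro2.T5SU11CoeffSphericalTransform
import Summits.Ventures.HodgeRepro2.T5SU11JacobiPhaseMoments

/-!
# The weight-`3` dossier: the explicit model `π₃⁺` of the owner's datum, in one place

Every statement of the spherical-function chapter specialised to the weight `k = 3` of the owner's
representation `π₃⁺` (N4.3), collected as one import point. Nothing is proved anew; each theorem is a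
two-line instance of a general row, named by the general row it instantiates:

* the transform of the lowest-`K`-type coefficient modulus `|⟨π_3(g) 1, 1⟩_3| = (π/2)(1 − |g·0|²)^{3/2}`:
  `∫_G |⟨π_3(g)1,1⟩_3| φ_λ dν = π²(1 − λ)/cos(πλ/2)` on `−1 < λ < 3`, `λ ≠ 1`, `= 2π` at `λ = 1`, and its
  domain of convergence `|λ − 1| < 2` exactly (`coeff_transform_three`, `coeff_transform_three_one`,
  `integrable_three_iff`);
* the Abel constant `C_3 = 2`, `C_3² = 4`, inside the Wendel envelope `π ≤ C_3² ≤ 3π/2`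
  (`abel_const_three_sq`, `abel_const_three_sq_mem`: a non-vacuity check of `T5SU11JacobiWendelBounds`);
* the law of the phase: under `(1 − |g·0|²)^{3/2} dν` (mass `2π`) the phase `log|a(g)|` is `Exp(1)` — tail
  `e^{−x}`, mean `1`, variance `1`, median `log 2`, all moments `n!` — the Cartan coordinate has
  `P(t > τ) = 1/cosh τ`, and the squared orbit radius `P(|g·0|² > y) = √(1 − y)`
  (`phase_tail_three`, `mean_phase_three`, `variance_phase_three`, `moment_phase_three`,
  `phase_median_three`, `cartan_tail_three`, `orbit_sq_tail_three`);
* the mean phase under `m_3 φ_λ dν` is `(d/dk) log m̂_k(λ)|_{k=3}` with the opposite sign, negative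
  (`deriv_log_jacobi_three_neg`).

Nothing is claimed about (N).

Blind lane: Mathlib + the HodgeRepro2 prefix only; no sorry; axioms ⊆ {propext, Classical.choice,
Quot.sound}.
-/

namespace Summit.Ventures.HodgeRepro2.T5SU11WeightThreeDossier

open MeasureTheory MeasureTheory.Measure Metric Set Filter Topology
open T5SU11Unimodular T5SU11Fibration T5SU11Cartan T5SU11CartanProjection T5HaarCircle
  T5BergmanCoefficient T5SU11FibrationHaar T5SU11SphericalFunction T5SU11JacobiIwasawa
  T5SU11JacobiTransform T5SU11JacobiThreshold T5SU11JacobiThreeFour T5SU11JacobiWendelBounds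
  T5SU11JacobiWeight T5SU11JacobiWeightDeriv T5SU11PhaseLaw T5SU11PhaseLawLintegral T5SU11PhaseTail
  T5SU11PhaseTailCartan T5SU11OrbitRadiusLaw T5SU11JacobiPhaseMoments T5SU11CoeffSphericalTransform
  T5BergmanPairing T5BergmanMatrixCoeff
open scoped Real ENNReal

/-! ### The Abel constant -/

/-- `C_3² = 4`. -/
theorem abel_const_three_sq : (√π * Real.Gamma ((3 - 1) / 2) / Real.Gamma (3 / 2)) ^ 2 = 4 := by
  rw [abel_const_three]
  norm_num

/-- **Non-vacuity of the Wendel envelope at the weight `3`**: `π ≤ C_3² = 4 ≤ 3π/2`, and numerically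
`3 < π < 4` makes both inequalities strict with room (`π < 4`, `4 < 4.5 < 3π/2`). -/
theorem abel_const_three_sq_mem :
    2 * π / (3 - 1) ≤ (√π * Real.Gamma ((3 - 1) / 2) / Real.Gamma (3 / 2)) ^ 2 ∧
      (√π * Real.Gamma ((3 - 1) / 2) / Real.Gamma (3 / 2)) ^ 2 ≤ 2 * π * 3 / (3 - 1) ^ 2 :=
  ⟨abel_const_sq_ge (by norm_num), abel_const_sq_le (by norm_num)⟩

/-- The same, numerically: `π < 4 < 3π/2`. -/
theorem abel_const_three_sq_strict : π < 4 ∧ (4 : ℝ) < 3 * π / 2 := by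
  have h1 := Real.pi_gt_three
  have h2 := Real.pi_lt_four
  constructor
  · exact h2
  · linarith

section measure

variable [MeasurableSpace Circle] [BorelSpace Circle]

/-! ### The coefficient transform -/

/-- `∫_G |⟨π_3(g)1,1⟩_3| φ_λ dν = π²(1 − λ)/cos(πλ/2)` on `−1 < λ < 3`, `λ ≠ 1`. -/
theorem coeff_transform_three {lam : ℝ} (h1 : -1 < lam) (h2 : lam < 3) (h3 : lam ≠ 1) :
    ∫ g, ‖matrixCoeff 3 lowest lowest g‖ * sph lam g ∂(nu haarCircle)
      = π ^ 2 * (1 - lam) / Real.cos (π * lam / 2) :=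
  integral_norm_matrixCoeff_three_mul_sph h1 h2 h3

/-- `∫_G |⟨π_3(g)1,1⟩_3| Ξ dν = 2π`. -/
theorem coeff_transform_three_one :
    ∫ g, ‖matrixCoeff 3 lowest lowest g‖ * sph 1 g ∂(nu haarCircle) = 2 * π :=
  integral_norm_matrixCoeff_three_mul_sph_one

/-- The transform of the weight-`3` modulus converges exactly for `|λ − 1| < 2`. -/
theorem integrable_three_iff (lam : ℝ) :
    Integrable (fun g => (1 - ‖orbit g‖ ^ 2) ^ ((3 : ℝ) / 2) * sph lam g) (nu haarCircle)
      ↔ |lam - 1| < 3 - 1 :=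
  integrable_orbit_rpow_mul_sph_iff' 3 lam

/-! ### The law of the phase at the weight `3` -/

/-- The mass: `∫_G (1 − |g·0|²)^{3/2} dν = 2π`. -/
theorem mass_three : ∫ g, (1 - ‖orbit g‖ ^ 2) ^ ((3 : ℝ) / 2) ∂(nu haarCircle) = 2 * π :=
  integral_orbit_rpow_three

/-- **The phase is `Exp(1)`**: `P_3(log|a| > x) = e^{−x}` for `x ≥ 0`. -/
theorem phase_tail_three {x : ℝ} (hx : 0 ≤ x) :
    (∫⁻ g, {g : SU11 | x < Real.log ‖mat g 0 0‖}.indicator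
        (fun g => ENNReal.ofReal ((1 - ‖orbit g‖ ^ 2) ^ ((3 : ℝ) / 2))) g ∂(nu haarCircle))
      / ENNReal.ofReal (2 * π / (3 - 2)) = ENNReal.ofReal (Real.exp (-x)) := by
  have h := phase_tail_prob (k := 3) (by norm_num) hx
  rwa [show -((3 - 2 : ℝ) * x) = -x by ring] at h

/-- The mean phase is `1`. -/
theorem mean_phase_three :
    (∫ g, Real.log ‖mat g 0 0‖ * (1 - ‖orbit g‖ ^ 2) ^ ((3 : ℝ) / 2) ∂(nu haarCircle))
        / ∫ g, (1 - ‖orbit g‖ ^ 2) ^ ((3 : ℝ) / 2) ∂(nu haarCircle) = 1 := by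
  rw [mean_phase (by norm_num)]
  norm_num

/-- The variance of the phase is `1`. -/
theorem variance_phase_three :
    (∫ g, Real.log ‖mat g 0 0‖ ^ 2 * (1 - ‖orbit g‖ ^ 2) ^ ((3 : ℝ) / 2) ∂(nu haarCircle))
        / (∫ g, (1 - ‖orbit g‖ ^ 2) ^ ((3 : ℝ) / 2) ∂(nu haarCircle))
      - ((∫ g, Real.log ‖mat g 0 0‖ * (1 - ‖orbit g‖ ^ 2) ^ ((3 : ℝ) / 2) ∂(nu haarCircle))
        / ∫ g, (1 - ‖orbit g‖ ^ 2) ^ ((3 : ℝ) / 2) ∂(nu haarCircle)) ^ 2 = 1 := by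
  rw [variance_phase (by norm_num)]
  norm_num

/-- All the moments: `⟨(log|a|)ⁿ⟩_{3,0} = n!`. -/
theorem moment_phase_three (n : ℕ) :
    (∫ g, Real.log ‖mat g 0 0‖ ^ n * (1 - ‖orbit g‖ ^ 2) ^ ((3 : ℝ) / 2) ∂(nu haarCircle))
        / ∫ g, (1 - ‖orbit g‖ ^ 2) ^ ((3 : ℝ) / 2) ∂(nu haarCircle) = (n.factorial : ℝ) := by
  rw [moment_phase n (by norm_num)]
  norm_num

/-- The median of the phase is `log 2`. -/
theorem phase_median_three :
    (∫⁻ g, {g : SU11 | Real.log 2 < Real.log ‖mat g 0 0‖}.indicator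
        (fun g => ENNReal.ofReal ((1 - ‖orbit g‖ ^ 2) ^ ((3 : ℝ) / 2))) g ∂(nu haarCircle))
      / ENNReal.ofReal (2 * π / (3 - 2)) = ENNReal.ofReal (1 / 2) := by
  have h := phase_median (k := 3) (by norm_num)
  rwa [show Real.log 2 / (3 - 2 : ℝ) = Real.log 2 by norm_num] at h

/-- The Cartan coordinate: `P_3(t(g) > τ) = 1/cosh τ`. -/
theorem cartan_tail_three {τ : ℝ} (hτ : 0 ≤ τ) :
    (∫⁻ g, {g : SU11 | τ < cartanT g}.indicator
        (fun g => ENNReal.ofReal ((1 - ‖orbit g‖ ^ 2) ^ ((3 : ℝ) / 2))) g ∂(nu haarCircle))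
      / ENNReal.ofReal (2 * π / (3 - 2)) = ENNReal.ofReal (Real.cosh τ)⁻¹ :=
  cartan_tail_prob_three hτ

/-- The squared orbit radius: `P_3(|g·0|² > y) = √(1 − y)`. -/
theorem orbit_sq_tail_three {y : ℝ} (hy0 : 0 ≤ y) (hy1 : y < 1) :
    (∫⁻ g, {g : SU11 | y < ‖orbit g‖ ^ 2}.indicator
        (fun g => ENNReal.ofReal ((1 - ‖orbit g‖ ^ 2) ^ ((3 : ℝ) / 2))) g ∂(nu haarCircle))
      / ENNReal.ofReal (2 * π / (3 - 2)) = ENNReal.ofReal (Real.sqrt (1 - y)) :=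
  orbit_sq_tail_prob_three hy0 hy1

/-! ### The weight derivative at `k = 3` -/

/-- `(d/dk) log m̂_k(λ) |_{k=3} < 0` on the strip `−1 < λ < 3`. -/
theorem deriv_log_jacobi_three_neg {lam : ℝ} (h1 : -1 < lam) (h2 : lam < 3) :
    deriv (fun k => Real.log (∫ g, (1 - ‖orbit g‖ ^ 2) ^ (k / 2) * sph lam g ∂(nu haarCircle)))
      (3 : ℝ) < 0 :=
  deriv_log_jacobi_weight_neg (by norm_num) h2 (by linarith)

end measure

end Summit.Ventures.HodgeRepro2.T5SU11WeightThreeDossier
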